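import Summits.CriticalPhenomena.PercolationContinuityZ3.Theorems.PercAnnulusCrossingIICNearSiteGivenFarUpper
import Summits.CriticalPhenomena.PercolationContinuityZ3.Theorems.PercAnnulusCrossingIICManyPointsTreeLower
import HarnessLib

/-!
# The k-point function of Kesten's IIC is at most `C^k ∏ π(merge distances)`: the spanning-tree upper bound (lane RSW3, p1 gen 21)

builds on p205010 (kernel theorem, internal audit signed; external expert review pending) — USED through `θ(p_c) = 0` (exact re-rooting).

RSW3 lane (LANE 3 `prim-rsw3`), seat `prim-rsw3-p1` (gen 21).  Helper file (`--supports stmt-CriticalPhenomena-4575`);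
no definitions, no sorries.  Memo `run/shared/lean/prim/rsw3/P1-QM.md` §34.5, §34.8.

THE UPPER HALF OF THE MST FORMULA: the induction of `…IICManyPointsTreeLower` with the near-site UPPER bound given a far configuration
(`…IICNearSiteGivenFarUpper`: `ν({0 ↔ v} ∩ {S ⊆ C(0)}) ≤ C·π(‖v‖)·ν(S ⊆ C(0))` for `S` off `Λ(4ls‖v‖)`) in place of the lower one: for sites
inserted top-down along a `4ls`-separated single-linkage dendrogram, **`ν(z_1, …, z_k ∈ C(0)) ≤ C^k ∏_{i} π_{p_c}(‖z_i − z_{p(i)}‖)`**.  With the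
lower half (separation `2l² + l ≤ 4ls`): **`ν(S ⊆ C(0)) ≍ ∏_{e ∈ MST({0} ∪ S)} π(|e|)`** up to `c^k, C^k`, for every `max(4ls, 2l²+l)`-separated
hierarchical configuration — THE k-POINT FUNCTION OF KESTEN'S INCIPIENT INFINITE CLUSTER IS THE MINIMAL SPANNING TREE.

* **`exists_iicMeasure_real_biInter_openConn_le_pow_mul_prod_criticalProbI`** — the spanning-tree upper bound.
References: H. Kesten, Probab. Theory Relat. Fields 73 (1986) §2, Thm. (8); D. Basu, A. Sapozhnikov, ECP 22 (2017) Thm. 1.1, Remark 2.1.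
-/

noncomputable section

namespace Summit.CriticalPhenomena.PercolationContinuityZ3.Theorems.Crossing

open MeasureTheory Filter Topology Literature.Probability.Percolation Literature.Probability.LatticeModels
open Literature.Probability.Percolation.DCT16
open Summit.CriticalPhenomena.PercolationContinuityZ3.Theorems.SurfaceTension

variable {d : ℕ}

open Classical in
/-- **THE k-POINT FUNCTION OF KESTEN'S IIC IS AT MOST `C^k ∏ π(merge distances)` — THE SPANNING-TREE UPPER BOUND** (`p_c(ℤ^d)`, `d ≥ 2`; (A2)□ at
aspect `(s,L)`, `2 ≤ s ≤ L`, `ϰ > 0`; `CU⁺_l(c_U)`, `l ≥ 2`, `c_U > 0`; UAD; `θ(p_c) = 0` via p205010 for the re-rooting): there are `n₀ ≥ 1` and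
`C > 0` such that for every IIC probability measure `ν`, every `k`, all sites `z_0 = 0, z_1, …, z_k` and parents `p(i) < i` (`1 ≤ i ≤ k`) with
`‖z_i − z_{p(i)}‖_∞ ≥ n₀` and `z_j − z_{p(i)} ∉ Λ(4ls·‖z_i − z_{p(i)}‖_∞)` for all `j < i`, `j ≠ p(i)` (the earlier sites and the root lie far
from the parent, on the scale of the new edge):
**`ν(⋂_{i=1}^{k} {0 ↔ z_i}) ≤ C^k · ∏_{i=1}^{k} π_{p_c}(‖z_i − z_{p(i)}‖_∞)`**.  When the sites are inserted top-down along a `4ls`-separated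
single-linkage dendrogram, the `‖z_i − z_{p(i)}‖` are the edge lengths of the minimal spanning tree of `{0, z_1, …, z_k}`: the upper half of
the formula `ν(S ⊆ C(0)) ≍ ∏_{e ∈ MST({0} ∪ S)} π(|e|)`. [cite: Kesten1986, Thm. (8)] [cite: BasuSapozhnikov2017ECP, Thm. 1.1 and Remark 2.1] -/
theorem exists_iicMeasure_real_biInter_openConn_le_pow_mul_prod_criticalProbI (hd : 2 ≤ d) {s L : ℕ} (hs : 2 ≤ s) (hsL : s ≤ L)
    {ϰ : ℝ} (hϰ : 0 < ϰ) (hA2 : SetToSetQuasiMultAspectAt d (criticalProbI d) s L ϰ) {l : ℕ} (hl : 2 ≤ l) {cU : ℝ} (hcU : 0 < cU)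
    (hCU : ∀ a : ℕ, 1 ≤ a → ∀ E : Set (BondConfig (Site d)), IsUpperSet E → MeasurableSet E →
      cU * (bondPercolation (zdGraph d) (criticalProbI d)).real E ≤ (bondPercolation (zdGraph d) (criticalProbI d)).real (E ∩
        {ω : BondConfig (Site d) | ∀ t ∈ innerBoundary (zdGraph d) (box d a), ∀ s ∈ innerBoundary (zdGraph d) (box d (l * a)),
          ∀ t' ∈ innerBoundary (zdGraph d) (box d a), ∀ s' ∈ innerBoundary (zdGraph d) (box d (l * a)),
          ω ∈ openConnIn (↑((box d (l * a) \ box d a) ∪ innerBoundary (zdGraph d) (box d a)) : Set (Site d)) t s →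
          ω ∈ openConnIn (↑((box d (l * a) \ box d a) ∪ innerBoundary (zdGraph d) (box d a)) : Set (Site d)) t' s' →
          ω ∈ openConnIn (↑((box d (l * a) \ box d a) ∪ innerBoundary (zdGraph d) (box d a)) : Set (Site d)) s s'}))
    (hUAD : ∀ ε : ℝ, 0 < ε → ∃ K₀ : ℕ, ∀ m : ℕ, 1 ≤ m → ∀ N : ℕ, K₀ * m ≤ N →
      (bondPercolation (zdGraph d) (criticalProbI d)).real (boxCrossing d m N) ≤ ε) :
    ∃ (n₀ : ℕ) (C : ℝ), 1 ≤ n₀ ∧ 0 < C ∧ ∀ (ν : Measure (BondConfig (Site d))) [IsProbabilityMeasure ν],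
      (∀ (F : Finset (Sym2 (Site d))) (E : Set (BondConfig (Site d))), MeasurableSet E → DeterminedBy E ↑F →
        Tendsto (fun n : ℕ => (bondPercolation (zdGraph d) (criticalProbI d)).real (E ∩ siteToBoundary d n) /
          oneArmProb d (criticalProbI d) n) atTop (𝓝 (ν.real E))) →
      ∀ (k : ℕ) (z : ℕ → Site d) (par : ℕ → ℕ), z 0 = 0 → (∀ i, 1 ≤ i → i ≤ k → par i < i) →
        (∀ i, 1 ≤ i → i ≤ k → n₀ ≤ Site.supNorm (z i - z (par i))) →
        (∀ i, 1 ≤ i → i ≤ k → ∀ j, j < i → j ≠ par i → z j - z (par i) ∉ box d (4 * l * s * Site.supNorm (z i - z (par i)))) →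
          ν.real (⋂ i ∈ Finset.Icc 1 k, (openConn (0 : Site d) (z i) : Set (BondConfig (Site d)))) ≤
            C ^ k * ∏ i ∈ Finset.Icc 1 k, oneArmProb d (criticalProbI d) (Site.supNorm (z i - z (par i))) := by
  have hd1 : 1 ≤ d := le_trans (by norm_num) hd
  have hp : 0 < ((criticalProbI d : unitInterval) : ℝ) := by
    rw [coe_criticalProbI]; exact criticalProb_zd_pos d hd1
  have hπ : ∀ m : ℕ, 0 < oneArmProb d (criticalProbI d) m := fun m => oneArmProb_pos hd1 _ hp m
  have hθ : theta (zdGraph d) 0 (criticalProbI d) = 0 := CSH.percolationContinuity_allDimensions d hd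
  obtain ⟨n₀, c, hn₀, hc, h9⟩ := exists_iicMeasure_real_openConn_inter_biInter_le_criticalProbI hd hs hsL hϰ hA2 hl hcU hCU hUAD
  refine ⟨n₀, c, hn₀, hc, fun ν _ hν k => ?_⟩
  have hreroot := fun (v : Site d) (T : Finset ℕ) (w : ℕ → Site d) =>
    iicMeasure_real_openConn_inter_biInter_eq_reroot hd1 _ hp hθ hs hϰ hA2 hν v T w
  induction k with
  | zero =>
    intro z par _ _ _ _
    have h0 : Finset.Icc 1 0 = ∅ := by rfl
    have hempty : (⋂ i ∈ (∅ : Finset ℕ), (openConn (0 : Site d) (z i) : Set (BondConfig (Site d)))) = Set.univ := by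
      ext ω; simp
    rw [h0, Finset.prod_empty, hempty, probReal_univ, pow_zero, one_mul]
  | succ k ih =>
    intro z par hz0 hpar hfar0 hsep
    -- the configuration up to `k`
    have ihk := ih z par hz0 (fun i h1 h2 => hpar i h1 (by omega)) (fun i h1 h2 => hfar0 i h1 (by omega))
      (fun i h1 h2 j hj hjp => hsep i h1 (by omega) j hj hjp)
    have hIcc : Finset.Icc 1 (k + 1) = insert (k + 1) (Finset.Icc 1 k) := by
      ext i; simp only [Finset.mem_Icc, Finset.mem_insert]; omega
    have hnot : k + 1 ∉ Finset.Icc 1 k := by simp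
    rw [hIcc, Finset.prod_insert hnot, Finset.set_biInter_insert]
    -- the new edge
    have hpk : par (k + 1) < k + 1 := hpar (k + 1) (by omega) le_rfl
    have hr : n₀ ≤ Site.supNorm (z (k + 1) - z (par (k + 1))) := hfar0 (k + 1) (by omega) le_rfl
    have hck : 0 ≤ c ^ k := pow_nonneg hc.le k
    have hπr := hπ (Site.supNorm (z (k + 1) - z (par (k + 1))))
    have hP : 0 ≤ ∏ i ∈ Finset.Icc 1 k, oneArmProb d (criticalProbI d) (Site.supNorm (z i - z (par i))) :=
      Finset.prod_nonneg fun i _ => measureReal_nonneg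
    by_cases hp0 : par (k + 1) = 0
    · -- the parent is the root: attach `z (k+1)` directly
      have hr0 : Site.supNorm (z (k + 1) - z (par (k + 1))) = Site.supNorm (z (k + 1)) := by rw [hp0, hz0, sub_zero]
      have hS : ∀ w ∈ (Finset.Icc 1 k).image z, w ∉ box d (4 * l * s * Site.supNorm (z (k + 1))) := by
        intro w hw
        obtain ⟨j, hj, rfl⟩ := Finset.mem_image.1 hw
        rw [Finset.mem_Icc] at hj
        have h := hsep (k + 1) (by omega) le_rfl j (by omega) (by rw [hp0]; omega)
        rwa [hp0, hz0, sub_zero, sub_zero] at h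
      have h := h9 ν hν (z (k + 1)) ((Finset.Icc 1 k).image z) (by rwa [hr0] at hr) hS
      rw [Finset.set_biInter_finset_image] at h
      rw [hr0]
      calc ν.real ((openConn (0 : Site d) (z (k + 1)) : Set (BondConfig (Site d))) ∩
            ⋂ i ∈ Finset.Icc 1 k, (openConn (0 : Site d) (z i) : Set (BondConfig (Site d))))
          ≤ c * oneArmProb d (criticalProbI d) (Site.supNorm (z (k + 1))) *
            ν.real (⋂ i ∈ Finset.Icc 1 k, (openConn (0 : Site d) (z i) : Set (BondConfig (Site d)))) := h
        _ ≤ c * oneArmProb d (criticalProbI d) (Site.supNorm (z (k + 1))) *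
            (c ^ k * ∏ i ∈ Finset.Icc 1 k, oneArmProb d (criticalProbI d) (Site.supNorm (z i - z (par i)))) :=
          mul_le_mul_of_nonneg_left ihk (mul_nonneg hc.le (hπ _).le)
        _ = c ^ (k + 1) * (oneArmProb d (criticalProbI d) (Site.supNorm (z (k + 1))) *
            ∏ i ∈ Finset.Icc 1 k, oneArmProb d (criticalProbI d) (Site.supNorm (z i - z (par i)))) := by ring
    · -- the parent is a site `v = z p`, `1 ≤ p ≤ k`: re-root at `v`
      have hp1 : 1 ≤ par (k + 1) := by omega
      have hpmem : par (k + 1) ∈ Finset.Icc 1 k := by rw [Finset.mem_Icc]; omega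
      -- `V_k = {0 ↔ v} ∩ W`
      have hVk : (⋂ i ∈ Finset.Icc 1 k, (openConn (0 : Site d) (z i) : Set (BondConfig (Site d)))) =
          (openConn (0 : Site d) (z (par (k + 1))) : Set (BondConfig (Site d))) ∩
            ⋂ i ∈ (Finset.Icc 1 k).erase (par (k + 1)), (openConn (0 : Site d) (z i) : Set (BondConfig (Site d))) := by
        rw [← Finset.insert_erase hpmem, Finset.set_biInter_insert, Finset.insert_erase hpmem]
      -- the target event as `{0 ↔ v} ∩ ⋂_{i ∈ T} {0 ↔ z i}`, `T = insert (k+1) (erase p)`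
      have hT : (openConn (0 : Site d) (z (k + 1)) : Set (BondConfig (Site d))) ∩
          ⋂ i ∈ Finset.Icc 1 k, (openConn (0 : Site d) (z i) : Set (BondConfig (Site d))) =
          (openConn (0 : Site d) (z (par (k + 1))) : Set (BondConfig (Site d))) ∩
            ⋂ i ∈ insert (k + 1) ((Finset.Icc 1 k).erase (par (k + 1))), (openConn (0 : Site d) (z i) : Set (BondConfig (Site d))) := by
        rw [hVk, Finset.set_biInter_insert, Set.inter_left_comm]
      rw [hT, hreroot (z (par (k + 1))) (insert (k + 1) ((Finset.Icc 1 k).erase (par (k + 1)))) z]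
      -- after re-rooting: `{0 ↔ z(k+1) − v} ∩ ({0 ↔ −v} ∩ ⋂_{erase} {0 ↔ z i − v})`
      rw [Finset.set_biInter_insert, Set.inter_left_comm]
      -- the far configuration seen from `v`
      have hS : ∀ w ∈ insert (-z (par (k + 1))) (((Finset.Icc 1 k).erase (par (k + 1))).image fun i => z i - z (par (k + 1))),
          w ∉ box d (4 * l * s * Site.supNorm (z (k + 1) - z (par (k + 1)))) := by
        intro w hw
        rcases Finset.mem_insert.1 hw with rfl | hw
        · have h := hsep (k + 1) (by omega) le_rfl 0 (by omega) (by omega)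
          rwa [hz0, zero_sub] at h
        · obtain ⟨j, hj, rfl⟩ := Finset.mem_image.1 hw
          rw [Finset.mem_erase, Finset.mem_Icc] at hj
          exact hsep (k + 1) (by omega) le_rfl j (by omega) hj.1
      have h := h9 ν hν (z (k + 1) - z (par (k + 1)))
        (insert (-z (par (k + 1))) (((Finset.Icc 1 k).erase (par (k + 1))).image fun i => z i - z (par (k + 1)))) hr hS
      rw [Finset.set_biInter_insert, Finset.set_biInter_finset_image] at h
      -- re-root back: `ν({0 ↔ −v} ∩ ⋂_{erase} {0 ↔ z i − v}) = ν({0 ↔ v} ∩ ⋂_{erase} {0 ↔ z i}) = ν(V_k)`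
      have hback : ν.real ((openConn (0 : Site d) (-z (par (k + 1))) : Set (BondConfig (Site d))) ∩
          ⋂ i ∈ (Finset.Icc 1 k).erase (par (k + 1)), (openConn (0 : Site d) (z i - z (par (k + 1))) : Set (BondConfig (Site d)))) =
          ν.real (⋂ i ∈ Finset.Icc 1 k, (openConn (0 : Site d) (z i) : Set (BondConfig (Site d)))) := by
        rw [hVk]; exact (hreroot (z (par (k + 1))) ((Finset.Icc 1 k).erase (par (k + 1))) z).symm
      rw [hback] at h
      refine h.trans ?_
      calc c * oneArmProb d (criticalProbI d) (Site.supNorm (z (k + 1) - z (par (k + 1)))) *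
            ν.real (⋂ i ∈ Finset.Icc 1 k, (openConn (0 : Site d) (z i) : Set (BondConfig (Site d))))
          ≤ c * oneArmProb d (criticalProbI d) (Site.supNorm (z (k + 1) - z (par (k + 1)))) *
            (c ^ k * ∏ i ∈ Finset.Icc 1 k, oneArmProb d (criticalProbI d) (Site.supNorm (z i - z (par i)))) :=
          mul_le_mul_of_nonneg_left ihk (mul_nonneg hc.le hπr.le)
        _ = c ^ (k + 1) * (oneArmProb d (criticalProbI d) (Site.supNorm (z (k + 1) - z (par (k + 1)))) *
            ∏ i ∈ Finset.Icc 1 k, oneArmProb d (criticalProbI d) (Site.supNorm (z i - z (par i)))) := by ring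

end Summit.CriticalPhenomena.PercolationContinuityZ3.Theorems.Crossing

end
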